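import Literature.MathematicalPhysics.QuantumFieldTheory.Balaban1983to89.T4EMLTangentInjective
import Mathlib.Analysis.Convex.SpecificFunctions.Deriv

/-!
# BalabanUVNodes ∕ N08 — THE QUANTITATIVE JACOBIAN LOWER BOUND OF THE PRINTED exp-mean-log FIBRE MAP:
# `‖D K_W (W X)‖_HS ≥ (1 − Σcᵢ)·(sin ρ∕ρ)·‖X‖_HS` on the guard (pub-balaban's tangent INJECTIVITY made quantitative)

WIDTH SEAT `pub-ymgap-dag-n08-w3` g4, `W-SEAT-START-LIST.md` v10 §0 (iii) successor piece of the item-3 lineage (parts 6–13, p594625 …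
p604469), 2026-08-28.  DAG node N08 = [Balaban1985UV3] Thm 1 p. 257 (compact) + Thm 2 p. 272; key item K1⁷ `StabilityBAtRecordR13SepCoPH`
(stmt-QuantumFields-20542), `--supports … --as helper`.  COUNT-NEUTRAL.

THE POINT.  ROAD (iv) of the E6′ seam is CLOSED (part 12B p603887) and n08-w1 g3 located THE LOAD POINT OF E6′ (p605761: exact Haar
compatibility is consumed by Theorem 1 ONLY through the history-mass cap `mass ≤ 1`, so the [B10] slot asks of [Balaban1985Averaging] (15) an
EXTENSIVE TRANSPORT ∕ JACOBIAN BOUND, not the exact identity).  By part 13's mixture normal form (p604469) the coarse bonds are, background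
by background, INDEPENDENT images of Haar variables under the one-variable fibre maps, which pub-balaban's `BlockAveragingEMLHaarAC`
(`coe_fibreCore_eq`) puts on the guard in the normal form `K_W = exp(Σᵢ cᵢ log(hᵢ W*))·W`, `cᵢ ≥ 0`, `Σcᵢ < 1` (at the [B10] slot
`1 − Σcᵢ = L^{1−d}`; part 11 p601453: at the flat background `K` IS the `L^{1−d}`-power map).  The analytic input behind ANY pointwise
transport bound is a LOWER BOUND ON THE JACOBIAN of `K`.  pub-balaban's `T4EMLTangentInjective` proves that the explicit strict
derivative `emlD h c W` kills no non-zero tangent vector (`emlD_tangent_injective`: enough for `HaarAC`, silent on densities).  Here: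

  `((1 − Σcᵢ)·sin ρ∕ρ)² · hs X X ≤ hs (emlD h c W (W X)) (emlD h c W (W X))`      (`emlD_tangent_lower_bound`)

for unitary `W`, unitaries `hᵢ` with `‖hᵢW* − 1‖ < 1∕2`, skew-Hermitian `X`, any `ρ ∈ (0, π)` with `‖Σᵢ cᵢ log(hᵢW*)‖ ≤ ρ`
(`hs A B = Re tr(Aᴴ B)`, the Hilbert–Schmidt form of `T4EMLTangentInjective` §1); hypothesis-free `ρ = log 2`
(`emlD_tangent_lower_bound_log_two`, constant `(1 − Σcᵢ)·sin(log 2)∕log 2 ≥ 0.92·(1 − Σcᵢ)`), read at the typed guard `deltaSU` of the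
printed average on `SU(N)` (`emlD_tangent_lower_bound_specialUnitary`, every `N`); at the flat background `hᵢ = W` the derivative IS
`(1 − Σcᵢ)·id` on tangent vectors (`emlD_flat`): the factor `1 − Σcᵢ` is SHARP.

THE MATHEMATICS ([folklore]; the inequality is IMPLICIT in pub-balaban's `core`).  `Zᵢ = log(hᵢW*)`, `Y = ΣcᵢZᵢ`, `X̃ = W X W*`.
(1) COERCIVITY (`coercive` = `core` with the kernel hypothesis removed): `(1 − Σcᵢ)·hs(X̃,X̃) ≤ hs(X̃, H_Y) − Σcᵢ hs(X̃, Hᵢ)` whenever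
`dexp(Zᵢ)Hᵢ = exp(Zᵢ)X̃`, `dexp(Y)H_Y = exp(Y)X̃` — KEY (Mittag-Leffler: `hs(X,X) − hs(X,H_Z) = Σₙ 2hs(A_Z X, (Rₙ + A_Z²)⁻¹A_Z X) ≥ 0`) at `Y`
and each `Zᵢ`, JENSEN (convexity of the defect in `Z`).  (2) `emlD h c W (W X)·W* = exp(Y)X̃ − dexp(Y)(ΣcᵢHᵢ) = dexp(Y)·G` and
`H_Y := G + ΣcᵢHᵢ` solves the `Y`-system, so (1) reads `(1 − Σcᵢ)hs(X̃,X̃) ≤ hs(X̃,G)`.  (3) SPECTRAL LOWER BOUND ∕ SURJECTIVITY of `dexp(Y)`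
(`dexp_lower_bound_and_surjective`): in a unitary eigenframe `Y = U diag(−iθ) U*`, `|θₐ| ≤ ‖Y‖ ≤ ρ`, `dexp(Y)` multiplies the `(a,b)`
coordinate by `dd(−iθₐ,−iθ_b)`, of modulus `|sin β∕β| ≥ sin ρ∕ρ` (`β = (θₐ−θ_b)∕2`; concavity of `sin` on `[0,π]`, `norm_dd_ge`).
(4) Cauchy–Schwarz (`hs_mul_self_le`): `(1 − Σc)²hs(X̃,X̃)² ≤ hs(X̃,G)² ≤ hs(X̃,X̃)hs(G,G) ≤ hs(X̃,X̃)(ρ∕sin ρ)²hs(E,E)`.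

NUMERICS (local, seconds; seat note `HOME/pub-ymgap-dag-n08-w3/N08-EML-JACOBIAN.md`; evidence for a CONJECTURE, used by no proof):
on `SU(2)` by quaternions, `λ := 1 − Σcᵢ ∈ {1∕9, 1∕27, 1∕100}`, 2–24 loop variables, equal∕random weights, random guarded families +
coordinate descent: `σ_min(D K_W) ≥ λ` to six digits in every run (equality on the abelian locus), `det ≥ λ³` with minimum AT the flat
background.  CONJECTURE (sharp): `σ_min ≥ 1 − Σcᵢ`; proved here: the `sin ρ∕ρ` version.

WHAT THIS DOES NOT DO (honest; count-neutral).  A Jacobian lower bound is ONE of two inputs of a fibre-law DENSITY bound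
`K_*(Haar↾guard) ≤ C·Haar` (the other: a quantitative form of pub-balaban's engine `T4HaarSUNLocalDiffeo` + a sheet count), which by
part 13 gives the ONE-STEP bound `rnTransport Ū f ≤ ‖f‖∞·C^{#PBond(j+1)}` a.e.; the k-UNIFORM mass bound `m_k ≤ e^{c_m|T₁^{(k)}|}` of
n08-w1's (R4⁗) letter `hmass` does NOT follow from per-level sup bounds (they compose to `Σ_{j≤k}|T₁^{(j)}|`) and is NOT claimed.  E6′ NOT
decided; N08 NOT discharged; counts unmoved (28∕28 · 5∕27); one finite 𝕋⁴ programme at fixed ε — R4 closes the CONDITIONAL rung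
`BalabanLadder.UV` only; the Yang–Mills mass gap (Clay) is NOT proved; nothing continuum ∕ OS.  Matrix analysis over Mathlib and
`T4EMLTangentInjective` (`key`, `jensen_step`, `frame`, `dexp_eigen`, `linmap_frame`, `emlD_apply` BY IMPORT); 0 `sorry`, 0 `def`, standard axioms.
-/

noncomputable section

open NormedSpace Finset
open scoped Matrix Matrix.Norms.L2Operator ComplexConjugate Nat

namespace Summit.QuantumFields.YangMills.BalabanUVNodes.N08HaarCompatibilityGuardJacobian

open Literature.MathematicalPhysics.QuantumFieldTheory.Balaban1983to89
open Literature.MathematicalPhysics.QuantumFieldTheory.Balaban1983to89.T4EMLTangentInjective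
open Matrix (single diagonal unitaryGroup)
open Complex (I)
open Literature.MathematicalPhysics.QuantumFieldTheory.Balaban1983to89.MatrixLog (mlog)

variable {m : Type*} [Fintype m]

/-! ## §1 Two elementary inequalities: Cauchy–Schwarz for `hs`, and `sin ρ∕ρ ≤ |sin β∕β|` for `|β| ≤ ρ ≤ π` -/

/-- `hs A 0 = 0`. [folklore] -/
theorem hs_zero_right (A : Matrix m m ℂ) : hs A 0 = 0 := by
  have h := hs_sub_right A (0 : Matrix m m ℂ) 0; rw [sub_zero] at h; linarith

/-- **Cauchy–Schwarz for the Hilbert–Schmidt form**: `hs(A,B)² ≤ hs(A,A)·hs(B,B)`. [folklore] -/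
theorem hs_mul_self_le (A B : Matrix m m ℂ) : hs A B * hs A B ≤ hs A A * hs B B := by
  have hb0 : 0 ≤ hs B B := hs_self_nonneg B
  have hexp : hs (((hs B B : ℝ) : ℂ) • A - ((hs A B : ℝ) : ℂ) • B) (((hs B B : ℝ) : ℂ) • A - ((hs A B : ℝ) : ℂ) • B)
      = hs B B * (hs B B * hs A A - hs A B * hs A B) := by
    rw [hs_sub_left, hs_sub_right, hs_sub_right, hs_smul_left, hs_smul_left, hs_smul_right, hs_smul_right,
      hs_smul_left, hs_smul_left, hs_smul_right, hs_smul_right, hs_comm A B]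
    ring
  have hnn : 0 ≤ hs B B * (hs B B * hs A A - hs A B * hs A B) := hexp ▸ hs_self_nonneg _
  rcases hb0.lt_or_eq with hbpos | hbz
  · nlinarith
  · have hB : B = 0 := hs_self_eq_zero hbz.symm
    have hp0 : hs A B = 0 := by rw [hB, hs_zero_right]
    rw [hp0, ← hbz]; simp

omit [Fintype m] in
/-- **`sin` is concave on `[0, π]`, so `sin ρ ∕ ρ ≤ sin β ∕ β` for `0 < β ≤ ρ ≤ π`**. [folklore] -/
theorem sin_div_le_sin_div {β ρ : ℝ} (hβ : 0 < β) (hβρ : β ≤ ρ) (hρπ : ρ ≤ Real.pi) :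
    Real.sin ρ / ρ ≤ Real.sin β / β := by
  have hρ : 0 < ρ := hβ.trans_le hβρ
  have hconc := strictConcaveOn_sin_Icc.concaveOn
  have h0 : (0 : ℝ) ∈ Set.Icc 0 Real.pi := ⟨le_rfl, Real.pi_pos.le⟩
  have h1 : ρ ∈ Set.Icc 0 Real.pi := ⟨hρ.le, hρπ⟩
  have ha : 0 ≤ 1 - β / ρ := sub_nonneg.2 ((div_le_one hρ).2 hβρ)
  have hb : 0 ≤ β / ρ := div_nonneg hβ.le hρ.le
  have key := hconc.2 h0 h1 ha hb (by ring)
  simp only [smul_eq_mul, mul_zero, zero_add, Real.sin_zero] at key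
  rw [div_mul_cancel₀ β hρ.ne'] at key
  rw [div_le_div_iff₀ hρ hβ]
  calc Real.sin ρ * β = β / ρ * Real.sin ρ * ρ := by field_simp
    _ ≤ Real.sin β * ρ := mul_le_mul_of_nonneg_right key hρ.le

omit [Fintype m] in
/-- `sin ρ ∕ ρ ≤ 1` for `0 < ρ`. [folklore] -/
theorem sin_div_le_one {ρ : ℝ} (hρ : 0 < ρ) : Real.sin ρ / ρ ≤ 1 := by
  rw [div_le_one hρ]; exact (Real.sin_lt hρ).le

omit [Fintype m] in
/-- **The divided differences of `exp` at the spectrum of a skew-Hermitian matrix are bounded below**: for `|θₐ|, |θ_b| ≤ ρ`,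
`0 < ρ ≤ π`: `sin ρ ∕ ρ ≤ |dd(−iθₐ, −iθ_b)|` (`= |sin β ∕ β|`, `β = (θₐ − θ_b)∕2`, off the diagonal; `= 1` on it). [folklore] -/
theorem norm_dd_ge {θa θb ρ : ℝ} (ha : |θa| ≤ ρ) (hb : |θb| ≤ ρ) (hρ : 0 < ρ) (hρπ : ρ ≤ Real.pi) :
    Real.sin ρ / ρ ≤ ‖dd (-I * θa) (-I * θb)‖ := by
  by_cases hab : θa = θb
  · subst hab
    rw [dd, if_pos rfl, Complex.norm_exp]
    have : (-I * (θa : ℂ)).re = 0 := by simp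
    rw [this, Real.exp_zero]
    exact sin_div_le_one hρ
  · have hpq : (-I * θa : ℂ) ≠ -I * θb := by
      intro h
      have := mul_left_cancel₀ (neg_ne_zero.2 Complex.I_ne_zero) h
      exact hab (Complex.ofReal_injective this)
    rw [dd, if_neg hpq, norm_div]
    have ht0 : (θb - θa) / 2 ≠ 0 := by
      intro h; apply hab; linarith [div_eq_zero_iff.1 h]
    have htρ : |(θb - θa) / 2| ≤ ρ := by
      rw [abs_div, abs_two]
      have h1 : |θb - θa| ≤ |θb| + |θa| := abs_sub _ _
      linarith
    have htπ : |(θb - θa) / 2| ≤ Real.pi := htρ.trans hρπ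
    have hnum : ‖Complex.exp (-I * θa) - Complex.exp (-I * θb)‖ = 2 * Real.sin |(θb - θa) / 2| := by
      have e1 : Complex.exp (-I * θa) - Complex.exp (-I * θb)
          = Complex.exp (-I * θb) * (Complex.exp (I * ((θb - θa : ℝ) : ℂ)) - 1) := by
        rw [mul_sub, mul_one, ← Complex.exp_add]
        congr 2
        push_cast
        ring
      rw [e1, norm_mul, Complex.norm_exp, Complex.norm_exp_I_mul_ofReal_sub_one]
      have : (-I * (θb : ℂ)).re = 0 := by simp
      rw [this, Real.exp_zero, one_mul, Real.norm_eq_abs, abs_mul, abs_two,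
        Real.abs_sin_eq_sin_abs_of_abs_le_pi htπ]
    have hden : ‖(-I * θa : ℂ) - -I * θb‖ = 2 * |(θb - θa) / 2| := by
      rw [show (-I * θa : ℂ) - -I * θb = -I * ((θa - θb : ℝ) : ℂ) by push_cast; ring, norm_mul, norm_neg,
        Complex.norm_I, one_mul, Complex.norm_real, Real.norm_eq_abs, show θa - θb = -(2 * ((θb - θa) / 2)) by ring,
        abs_neg, abs_mul, abs_two]
    rw [hnum, hden, mul_div_mul_left _ _ (two_ne_zero)]
    exact sin_div_le_sin_div (abs_pos.2 ht0) htρ hρπ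

variable [DecidableEq m] [Nonempty m]

/-! ## §2 The spectral lower bound and the surjectivity of `dexp Y` for skew-Hermitian `Y`, `‖Y‖ ≤ ρ < π` -/

/-- **`dexp(Y)` IS BOUNDED BELOW BY `sin ρ∕ρ` IN HILBERT–SCHMIDT NORM AND IS ONTO**, for skew-Hermitian `Y` with `‖Y‖ ≤ ρ`,
`0 < ρ < π`: in a unitary eigenframe `Y = U diag(−iθ) U*` (`frame`) the operator `dexp Y` multiplies the `(a,b)` frame coordinate
by `dd(−iθₐ,−iθ_b)` (`dexp_eigen`), of modulus `≥ sin ρ∕ρ > 0` (`norm_dd_ge`). [folklore] -/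
theorem dexp_lower_bound_and_surjective {Y : Matrix m m ℂ} (hY : Yᴴ = -Y) {ρ : ℝ} (hρ : 0 < ρ) (hρπ : ρ < Real.pi)
    (hYρ : ‖Y‖ ≤ ρ) :
    (∀ G : Matrix m m ℂ, (Real.sin ρ / ρ) ^ 2 * hs G G ≤ hs (dexp Y G) (dexp Y G)) ∧ (∀ M : Matrix m m ℂ, ∃ G : Matrix m m ℂ, dexp Y G = M) := by
  obtain ⟨U, θ, hU, hU', hYU, hθ⟩ := frame hY
  have hθρ : ∀ a, |θ a| ≤ ρ := fun a => (hθ a).trans hYρ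
  have hl : ∀ a b, Y * Fu U a b = (-I * (θ a : ℂ)) • Fu U a b := fun a b => by
    rw [hYU]; exact frame_mul_Fu hU _ a b
  have hr : ∀ a b, Fu U a b * Y = (-I * (θ b : ℂ)) • Fu U a b := fun a b => by
    rw [hYU]; exact Fu_mul_frame hU _ a b
  have hdexp : ∀ a b, dexp Y (Fu U a b) = dd (-I * θ a) (-I * θ b) • Fu U a b := fun a b =>
    dexp_eigen (hl a b) (hr a b)
  have hdd : ∀ a b, Real.sin ρ / ρ ≤ ‖dd (-I * θ a) (-I * θ b)‖ := fun a b =>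
    norm_dd_ge (hθρ a) (hθρ b) hρ hρπ.le
  have hs0 : 0 < Real.sin ρ / ρ := div_pos (Real.sin_pos_of_pos_of_lt_pi hρ hρπ) hρ
  have hdd0 : ∀ a b, dd (-I * θ a) (-I * θ b) ≠ 0 := fun a b h => by
    have := hdd a b; rw [h, norm_zero] at this; linarith
  refine ⟨fun G => ?_, fun M => ?_⟩
  · set G' : Matrix m m ℂ := star U * G * U with hG'
    have hGU : G = U * G' * star U := (conj_unconj hU' G).symm
    have h1 : dexp Y G = U * Matrix.of (fun a b => dd (-I * θ a) (-I * θ b) * G' a b) * star U := by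
      rw [hGU]; exact linmap_frame (dexp Y).toLinearMap _ hdexp G'
    rw [h1, hGU, hs_frame hU, hs_frame hU, Finset.mul_sum]
    refine Finset.sum_le_sum fun a _ => ?_
    rw [Finset.mul_sum]
    refine Finset.sum_le_sum fun b _ => ?_
    rw [Matrix.of_apply, Complex.star_def, Complex.conj_mul', Complex.conj_mul',
      ← Complex.ofReal_pow, ← Complex.ofReal_pow, Complex.ofReal_re, Complex.ofReal_re, norm_mul, mul_pow]
    exact mul_le_mul_of_nonneg_right (pow_le_pow_left₀ hs0.le (hdd a b) 2) (sq_nonneg _)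
  · set M' : Matrix m m ℂ := star U * M * U with hM'
    have hMU : M = U * M' * star U := (conj_unconj hU' M).symm
    refine ⟨U * Matrix.of (fun a b => M' a b / dd (-I * θ a) (-I * θ b)) * star U, ?_⟩
    have h1 : dexp Y (U * Matrix.of (fun a b => M' a b / dd (-I * θ a) (-I * θ b)) * star U)
        = U * Matrix.of (fun a b => dd (-I * θ a) (-I * θ b) * (M' a b / dd (-I * θ a) (-I * θ b))) * star U :=
      linmap_frame (dexp Y).toLinearMap _ hdexp _
    rw [h1, hMU]
    congr 2; ext a b
    rw [Matrix.of_apply, mul_div_cancel₀ _ (hdd0 a b)]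

/-! ## §3 COERCIVITY: pub-balaban's `core` with the kernel hypothesis removed -/

/-- **COERCIVITY OF THE exp-mean-log TANGENT SYSTEM.**  `Zᵢ` skew-Hermitian with `‖Zᵢ‖ ≤ 1`, weights `cᵢ ≥ 0`, `Σ cᵢ < 1`,
`Y = Σ cᵢ Zᵢ`; if `dexp(Zᵢ) Hᵢ = exp(Zᵢ) X` for all `i` and `dexp(Y) H_Y = exp(Y) X`, then
`(1 − Σcᵢ)·hs(X,X) ≤ hs(X, H_Y) − Σ cᵢ·hs(X, Hᵢ)`.  The proof is `T4EMLTangentInjective.core` verbatim (KEY at `Y` and at each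
`Zᵢ`, the Jensen step termwise, `hasSum_le`) with `H_Y` kept free instead of `= Σ cᵢ Hᵢ`; at `H_Y = Σ cᵢ Hᵢ` it returns
`core` (`(1 − Σcᵢ)hs(X,X) ≤ 0`). [folklore] -/
theorem coercive {ι : Type*} [Fintype ι] {Z : ι → Matrix m m ℂ} (hZ : ∀ i, (Z i)ᴴ = -Z i) (hZ1 : ∀ i, ‖Z i‖ ≤ 1)
    (c : ι → ℝ) (hc0 : ∀ i, 0 ≤ c i) (hc1 : ∑ i, c i < 1) (X : Matrix m m ℂ) (H : ι → Matrix m m ℂ) (HY : Matrix m m ℂ)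
    (hH : ∀ i, dexp (Z i) (H i) = exp (Z i) * X)
    (hY : dexp (∑ i, (c i : ℂ) • Z i) HY = exp (∑ i, (c i : ℂ) • Z i) * X) :
    (1 - ∑ i, c i) * hs X X ≤ hs X HY - ∑ i, c i * hs X (H i) := by
  have hπ3 : (3 : ℝ) < Real.pi := Real.pi_gt_three
  have hYn : ‖∑ i, (c i : ℂ) • Z i‖ < Real.pi := by
    calc ‖∑ i, (c i : ℂ) • Z i‖ ≤ ∑ i, ‖(c i : ℂ) • Z i‖ := norm_sum_le _ _
      _ ≤ ∑ i, c i := Finset.sum_le_sum fun i _ => by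
          rw [norm_smul, Complex.norm_real, Real.norm_of_nonneg (hc0 i)]
          nlinarith [hZ1 i, hc0 i, norm_nonneg (Z i)]
      _ < Real.pi := by linarith
  have hZn : ∀ i, ‖Z i‖ < Real.pi := fun i => by linarith [hZ1 i]
  obtain ⟨-, v, hv, hsumY⟩ := key (conjTranspose_sum_smul c hZ) hYn X _ hY
  have kZ := fun i => key (hZ i) (hZn i) X (H i) (hH i)
  choose w hw hsumw using fun i => (kZ i).2
  have hposZ : ∀ i (n : ℕ) (M : Matrix m m ℂ), 0 ≤ hs M (Pop (Rn n) (Z i) M) := fun i => (kZ i).1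
  have hle : ∀ n, 2 * hs (adh (∑ i, (c i : ℂ) • Z i) X) (v n) ≤ ∑ i, c i * (2 * hs (adh (Z i) X) (w i n)) := by
    intro n
    have hj := jensen_step (Rn_nonneg n) hZ c hc0 hc1.le X (v n) (fun i => w i n) (hv n)
      (fun i => hw i n) (fun i M => hposZ i n M)
    calc 2 * hs (adh (∑ i, (c i : ℂ) • Z i) X) (v n) ≤ 2 * ∑ i, c i * hs (adh (Z i) X) (w i n) := by
          linarith
      _ = ∑ i, c i * (2 * hs (adh (Z i) X) (w i n)) := by
          rw [Finset.mul_sum]; exact Finset.sum_congr rfl fun i _ => by ring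
  have hsum2 : HasSum (fun n => ∑ i, c i * (2 * hs (adh (Z i) X) (w i n)))
      (∑ i, c i * (hs X X - hs X (H i))) :=
    hasSum_sum fun i _ => (hsumw i).mul_left (c i)
  have hineq := hasSum_le hle hsumY hsum2
  have e2 : ∑ i, c i * (hs X X - hs X (H i)) = (∑ i, c i) * hs X X - ∑ i, c i * hs X (H i) := by
    rw [Finset.sum_mul, ← Finset.sum_sub_distrib]
    exact Finset.sum_congr rfl fun i _ => by ring
  rw [e2] at hineq
  linarith

/-! ## §4 THE QUANTITATIVE TANGENT LOWER BOUND for the fibre map `K_W = exp(Σᵢ cᵢ log(hᵢ W*))·W` -/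

variable {ι : Type*} [Fintype ι]

omit [Nonempty m] in
/-- `hs` is invariant under right multiplication by a unitary: `hs (A W*) (B W*) = hs A B` for `W* W = 1`. [folklore] -/
theorem hs_mul_star_unitary {W : Matrix m m ℂ} (hW1 : star W * W = 1) (A B : Matrix m m ℂ) :
    hs (A * star W) (B * star W) = hs A B := by
  rw [hs, hsC_mul_right, hs]
  congr 1
  rw [show (star W : Matrix m m ℂ)ᴴ = W by rw [← Matrix.star_eq_conjTranspose, star_star], Matrix.mul_assoc, hW1, Matrix.mul_one]

/-- ★★★ **THE QUANTITATIVE JACOBIAN LOWER BOUND OF THE PRINTED exp-mean-log FIBRE MAP.**  For unitary `W`, unitaries `hᵢ` in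
the guard `‖hᵢ W* − 1‖ < 1∕2`, weights `cᵢ ≥ 0` with `Σcᵢ < 1`, a skew-Hermitian `X`, and any `ρ ∈ (0, π)` bounding
`‖Σᵢ cᵢ log(hᵢ W*)‖`:
  `((1 − Σcᵢ)·(sin ρ∕ρ))² · hs(X,X) ≤ hs(D K_W(W X), D K_W(W X))`,
i.e. `‖emlD h c W (W X)‖_HS ≥ (1 − Σcᵢ)(sin ρ∕ρ)‖X‖_HS`: the tangent map of `K` at `W` shrinks no tangent vector by more than the
factor `(1 − Σcᵢ)·sin ρ∕ρ` — pub-balaban's `emlD_tangent_injective` (the case `emlD … = 0`) made quantitative; by `emlD_flat` the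
factor `1 − Σcᵢ` is attained at the flat background. [folklore] -/
theorem emlD_tangent_lower_bound {h : ι → Matrix m m ℂ} (hh : ∀ i, h i ∈ unitaryGroup m ℂ) {W : Matrix m m ℂ} (hWu : W ∈ unitaryGroup m ℂ)
    (hg : ∀ i, ‖h i * star W - 1‖ < 1 / 2) {c : ι → ℝ} (hc0 : ∀ i, 0 ≤ c i) (hc1 : ∑ i, c i < 1)
    (X : Matrix m m ℂ) (hX : Xᴴ = -X) {ρ : ℝ} (hρ : 0 < ρ) (hρπ : ρ < Real.pi)
    (hYρ : ‖∑ i, (c i : ℂ) • mlog (h i * star W)‖ ≤ ρ) :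
    ((1 - ∑ i, c i) * (Real.sin ρ / ρ)) ^ 2 * hs X X ≤ hs (emlD h c W (W * X)) (emlD h c W (W * X)) := by
  have hW1 : star W * W = 1 := Matrix.mem_unitaryGroup_iff'.mp hWu
  have hW2 : W * star W = 1 := Matrix.mem_unitaryGroup_iff.mp hWu
  have hPu : ∀ i, h i * star W ∈ unitaryGroup m ℂ := fun i => mul_mem (hh i) (Unitary.star_mem hWu)
  have hP1 : ∀ i, ‖h i * star W - 1‖ < 1 := fun i => lt_trans (hg i) (by norm_num)
  have hZskew : ∀ i, (mlog (h i * star W))ᴴ = -mlog (h i * star W) := fun i => by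
    rw [← Matrix.star_eq_conjTranspose]; exact star_mlog_of_unitary (hPu i) (hg i)
  have hZ1 : ∀ i, ‖mlog (h i * star W)‖ ≤ 1 := fun i => by
    have h1 := norm_mlog_lt_log_two (hg i); have h2 := Real.log_two_lt_d9; linarith
  have hX' : star X = -X := by rw [Matrix.star_eq_conjTranspose, hX]
  set Y : Matrix m m ℂ := ∑ i, (c i : ℂ) • mlog (h i * star W)
  set Xt : Matrix m m ℂ := W * X * star W with hXt
  set E : Matrix m m ℂ := emlD h c W (W * X)
  set H : ι → Matrix m m ℂ := fun i => fderiv ℂ mlog (h i * star W) (h i * star W * Xt)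
  have hHi : ∀ i, dexp (mlog (h i * star W)) (H i) = exp (mlog (h i * star W)) * Xt := fun i => by
    show dexp (mlog (h i * star W)) (fderiv ℂ mlog (h i * star W) (h i * star W * Xt)) = _
    rw [dexp_mlog_fderiv (hP1 i), MatrixLog.exp_mlog (hP1 i)]
  have hPX : ∀ i, h i * star (W * X) = -(h i * star W * Xt) := by
    intro i
    rw [star_mul, hX', neg_mul, mul_neg, hXt, show h i * star W * (W * X * star W)
      = h i * (star W * W) * (X * star W) by noncomm_ring, hW1, mul_one]
  have hE : E * star W = exp Y * Xt - dexp Y (∑ i, (c i : ℂ) • H i) := by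
    have h0 : E = exp Y * (W * X) + dexp Y (∑ i, (c i : ℂ) • fderiv ℂ mlog (h i * star W) (h i * star (W * X))) * W :=
      emlD_apply h c W (W * X)
    have h1 : (∑ i, (c i : ℂ) • fderiv ℂ mlog (h i * star W) (h i * star (W * X))) = -∑ i, (c i : ℂ) • H i := by
      rw [← Finset.sum_neg_distrib]
      refine Finset.sum_congr rfl fun i _ => ?_
      rw [hPX, map_neg, smul_neg]
    have h0' : E = exp Y * (W * X) - dexp Y (∑ i, (c i : ℂ) • H i) * W := by
      rw [h0, h1, map_neg, neg_mul, ← sub_eq_add_neg]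
    rw [h0', hXt, sub_mul, mul_assoc, mul_assoc (dexp Y _) W (star W), hW2, mul_one]
  have hYskew : Yᴴ = -Y := conjTranspose_sum_smul c hZskew
  obtain ⟨hlow, hsurj⟩ := dexp_lower_bound_and_surjective hYskew hρ hρπ hYρ
  obtain ⟨G, hG⟩ := hsurj (E * star W)
  have hY : dexp Y (G + ∑ i, (c i : ℂ) • H i) = exp Y * Xt := by
    rw [map_add, hG, hE]; abel
  have hco := coercive hZskew hZ1 c hc0 hc1 Xt H _ hHi hY
  have hco' : (1 - ∑ i, c i) * hs Xt Xt ≤ hs Xt G := by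
    have e1 : hs Xt (G + ∑ i, (c i : ℂ) • H i) = hs Xt G + ∑ i, c i * hs Xt (H i) := by
      rw [hs_add_right, hs_sum_right]
      congr 1
      exact Finset.sum_congr rfl fun i _ => hs_smul_right _ _ _
    rw [e1] at hco
    linarith
  have hsp : (Real.sin ρ / ρ) ^ 2 * hs G G ≤ hs E E := by
    have h1 := hlow G; rwa [hG, hs_mul_star_unitary hW1] at h1
  have hcs := hs_mul_self_le Xt G
  have hXX : hs Xt Xt = hs X X := by rw [hXt]; exact hs_conj hW1 X X
  have hlam : 0 < 1 - ∑ i, c i := by linarith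
  have hs0 : 0 ≤ Real.sin ρ / ρ := (div_pos (Real.sin_pos_of_pos_of_lt_pi hρ hρπ) hρ).le
  have ha0 : 0 ≤ hs Xt Xt := hs_self_nonneg _
  have hEE : 0 ≤ hs E E := hs_self_nonneg _
  rw [← hXX]
  rcases ha0.lt_or_eq with hapos | haz
  · have hp0 : 0 ≤ hs Xt G := le_trans (mul_nonneg hlam.le ha0) hco'
    have h1 : (1 - ∑ i, c i) ^ 2 * (hs Xt Xt * hs Xt Xt) ≤ hs Xt Xt * hs G G := by
      calc (1 - ∑ i, c i) ^ 2 * (hs Xt Xt * hs Xt Xt) = ((1 - ∑ i, c i) * hs Xt Xt) * ((1 - ∑ i, c i) * hs Xt Xt) := by ring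
        _ ≤ hs Xt G * hs Xt G := mul_le_mul hco' hco' (mul_nonneg hlam.le ha0) hp0
        _ ≤ hs Xt Xt * hs G G := hcs
    have h2 : (1 - ∑ i, c i) ^ 2 * hs Xt Xt ≤ hs G G := by
      by_contra hcon; push Not at hcon
      nlinarith [h1, hapos, mul_lt_mul_of_pos_right hcon hapos]
    calc ((1 - ∑ i, c i) * (Real.sin ρ / ρ)) ^ 2 * hs Xt Xt
          = (Real.sin ρ / ρ) ^ 2 * ((1 - ∑ i, c i) ^ 2 * hs Xt Xt) := by ring
      _ ≤ (Real.sin ρ / ρ) ^ 2 * hs G G := mul_le_mul_of_nonneg_left h2 (sq_nonneg _)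
      _ ≤ hs E E := hsp
  · rw [← haz, mul_zero]; exact hEE

/-- ★★ **THE HYPOTHESIS-FREE CONSTANT `ρ = log 2`**: on the guard `‖log(hᵢW*)‖ < log 2`, so `‖Σcᵢ log(hᵢW*)‖ ≤ log 2 < π` and
`((1 − Σcᵢ)·sin(log 2)∕log 2)²·hs(X,X) ≤ hs(D K_W(WX), D K_W(WX))` — `sin(log 2)∕log 2 = 0.9219…`. [folklore] -/
theorem emlD_tangent_lower_bound_log_two {h : ι → Matrix m m ℂ} (hh : ∀ i, h i ∈ unitaryGroup m ℂ) {W : Matrix m m ℂ}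
    (hWu : W ∈ unitaryGroup m ℂ) (hg : ∀ i, ‖h i * star W - 1‖ < 1 / 2) {c : ι → ℝ} (hc0 : ∀ i, 0 ≤ c i)
    (hc1 : ∑ i, c i < 1) (X : Matrix m m ℂ) (hX : Xᴴ = -X) :
    ((1 - ∑ i, c i) * (Real.sin (Real.log 2) / Real.log 2)) ^ 2 * hs X X
      ≤ hs (emlD h c W (W * X)) (emlD h c W (W * X)) := by
  have hl2 : 0 < Real.log 2 := Real.log_pos one_lt_two
  have hl2π : Real.log 2 < Real.pi := by
    have h1 := Real.log_two_lt_d9; have h2 := Real.pi_gt_three; linarith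
  refine emlD_tangent_lower_bound hh hWu hg hc0 hc1 X hX hl2 hl2π ?_
  calc ‖∑ i, (c i : ℂ) • mlog (h i * star W)‖ ≤ ∑ i, ‖(c i : ℂ) • mlog (h i * star W)‖ := norm_sum_le _ _
    _ ≤ ∑ i, c i * Real.log 2 := Finset.sum_le_sum fun i _ => by
        rw [norm_smul, Complex.norm_real, Real.norm_of_nonneg (hc0 i)]
        exact mul_le_mul_of_nonneg_left (norm_mlog_lt_log_two (hg i)).le (hc0 i)
    _ = (∑ i, c i) * Real.log 2 := by rw [Finset.sum_mul]
    _ ≤ 1 * Real.log 2 := mul_le_mul_of_nonneg_right hc1.le hl2.le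
    _ = Real.log 2 := one_mul _

/-- ★★ **AT THE TYPED GUARD OF THE PRINTED AVERAGE ON `SU(N)`** (`ExpMeanLog.expMeanLogSU`: radius `deltaSU = min(1∕3, π∕N)`;
pub-balaban's fibre normal form `BlockAveragingEMLHaarAC.coe_fibreCore_eq` has its `h_k W*` inside `‖· − 1‖ < 1∕3`): for
`hᵢ, W ∈ SU(N)` with `‖hᵢW* − 1‖ < deltaSU` and skew-Hermitian `X`, the `log 2` bound holds verbatim — one `W`-UNIFORM constant
`(1 − Σcᵢ)·sin(log 2)∕log 2` on the whole guard, every `N`. [folklore] -/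
theorem emlD_tangent_lower_bound_specialUnitary {n : Type} [DecidableEq n] [Fintype n] [Nonempty n]
    (h : ι → Matrix.specialUnitaryGroup n ℂ) (W : Matrix.specialUnitaryGroup n ℂ)
    (hg : ∀ i, ‖(h i : Matrix n n ℂ) * star (W : Matrix n n ℂ) - 1‖ < ExpMeanLog.deltaSU n)
    {c : ι → ℝ} (hc0 : ∀ i, 0 ≤ c i) (hc1 : ∑ i, c i < 1) (X : Matrix n n ℂ) (hX : Xᴴ = -X) :
    ((1 - ∑ i, c i) * (Real.sin (Real.log 2) / Real.log 2)) ^ 2 * hs X X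
      ≤ hs (emlD (fun i => (h i : Matrix n n ℂ)) c W (W * X)) (emlD (fun i => (h i : Matrix n n ℂ)) c W (W * X)) := by
  have hh : ∀ i, (h i : Matrix n n ℂ) ∈ unitaryGroup n ℂ := fun i => (Matrix.mem_specialUnitaryGroup_iff.mp (h i).2).1
  have hWu : (W : Matrix n n ℂ) ∈ unitaryGroup n ℂ := (Matrix.mem_specialUnitaryGroup_iff.mp W.2).1
  have hg' : ∀ i, ‖(h i : Matrix n n ℂ) * star (W : Matrix n n ℂ) - 1‖ < 1 / 2 := fun i => by
    have := ExpMeanLog.lt_third_of_lt_deltaSU (hg i); linarith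
  exact emlD_tangent_lower_bound_log_two hh hWu hg' hc0 hc1 X hX

/-! ### Sharpness: at the flat background the tangent map IS `(1 − Σcᵢ)·id` -/

/-- `dexp 0 = id`: `dexp 0 F = dd(0,0)·F = e⁰·F = F`. [folklore] -/
theorem dexp_zero_apply (F : Matrix m m ℂ) : dexp (0 : Matrix m m ℂ) F = F := by
  have h := dexp_eigen (Z := (0 : Matrix m m ℂ)) (F := F) (p := 0) (q := 0) (by simp) (by simp)
  rw [h, dd, if_pos rfl, Complex.exp_zero, one_smul]

/-- `D log(1) = id`: the derivative of the series logarithm at the identity. [folklore] -/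
theorem fderiv_mlog_one_apply (M : Matrix m m ℂ) : fderiv ℂ mlog (1 : Matrix m m ℂ) M = M := by
  have h := dexp_mlog_fderiv (P := (1 : Matrix m m ℂ)) (by rw [sub_self, norm_zero]; exact one_pos) M
  rwa [MatrixLog.mlog_one, dexp_zero_apply] at h

/-- ★ **SHARPNESS AT THE FLAT BACKGROUND.**  If every `hᵢ = W` (all loop variables of the private coordinate trivial: the flat
background of part 11, where `K` is the `(1 − Σcᵢ)`-power map), then `D K_W (W X) = (1 − Σcᵢ)·(W X)` for skew-Hermitian `X`:
the factor `1 − Σcᵢ` of `emlD_tangent_lower_bound` cannot be improved. [folklore] -/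
theorem emlD_flat {W : Matrix m m ℂ} (hWu : W ∈ unitaryGroup m ℂ) (c : ι → ℝ) (X : Matrix m m ℂ) (hX : Xᴴ = -X) :
    emlD (fun _ : ι => W) c W (W * X) = ((1 - ∑ i, c i : ℝ) : ℂ) • (W * X) := by
  have hW1 : star W * W = 1 := Matrix.mem_unitaryGroup_iff'.mp hWu
  have hW2 : W * star W = 1 := Matrix.mem_unitaryGroup_iff.mp hWu
  have hX' : star X = -X := by rw [Matrix.star_eq_conjTranspose, hX]
  rw [emlD_apply]
  have h1 : (∑ i, (c i : ℂ) • mlog (W * star W)) = 0 := by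
    rw [hW2, MatrixLog.mlog_one]; simp
  have h2 : fderiv ℂ mlog (W * star W) (W * star (W * X)) = -(W * X * star W) := by
    rw [hW2, fderiv_mlog_one_apply, star_mul, hX']
    noncomm_ring
  simp only [h1, NormedSpace.exp_zero, one_mul, dexp_zero_apply, h2, smul_neg, Finset.sum_neg_distrib, neg_mul]
  rw [← Finset.sum_smul, Matrix.smul_mul, show W * X * star W * W = W * X * (star W * W) by noncomm_ring, hW1, mul_one]
  rw [show ((1 - ∑ i, c i : ℝ) : ℂ) = 1 - ∑ i, (c i : ℂ) by push_cast; rfl, sub_smul, one_smul, sub_eq_add_neg]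

end Summit.QuantumFields.YangMills.BalabanUVNodes.N08HaarCompatibilityGuardJacobian
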